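import Summits.CriticalPhenomena.PercolationContinuityZ3.Theses.PercNearOneGluing
import Literature.Probability.Percolation.PercolationProofs
import Literature.Probability.Percolation.ConditionalPositiveAssociationProofs
import Literature.Probability.Percolation.TwoClusterConditionalAssociationProofs
import Literature.Probability.LatticeModels.ProdBernoulliIndependence
import Literature.Probability.Percolation.SharpnessDCTProofs
import Summits.CriticalPhenomena.PercolationContinuityZ3.Theorems.PercNearOneGluingAdditiveGluingGoodPocketMarkov

/-! TTRL-lite variant V1419 of stmt-CriticalPhenomena-4576 -/

namespace Summit.CriticalPhenomena.PercolationContinuityZ3.Theorems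

open MeasureTheory Literature.Probability.LatticeModels Literature.Probability.Percolation
open scoped Classical BigOperators

/-- **Dead-pocket Markov property, positive form** (TTRL-lite variant V1419 of
stmt-CriticalPhenomena-4576, stub `stub_goodStep`): under the product Bernoulli bond measure
`prodBernoulli w` on `Fin n`, the event `{C(o) = W}` and the restricted connection
`{a ↔ b in Wᶜ}` are independent — the first is determined by the pairs meeting `W`
(`goodPM_determinedBy_cluster_eq`), the second by the pairs inside `Wᶜ`
(`DCT16.determinedBy_openConnIn`), two disjoint sets of coordinates
(`prodBernoulli_real_inter_of_determinedBy_disjoint`).  No hypothesis is needed: if `o ∉ W`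
the event `{C(o) = W}` is empty (`o ∈ C(o)`) and both sides vanish.
[folklore; Kozma–Nitzan arXiv:2401.12397, proof of Thm 5] -/
theorem stub_goodStep_var1419 :
    ∀ (n : ℕ) (w : Sym2 (Fin n) → unitInterval) (W : Finset (Fin n)) (o a b : Fin n),
      (prodBernoulli w).real
          ({ω : BondConfig (Fin n) | openCluster ω o = (W : Set (Fin n))} ∩
            openConnIn ((W : Set (Fin n))ᶜ) a b) =
        (prodBernoulli w).real {ω : BondConfig (Fin n) | openCluster ω o = (W : Set (Fin n))} *
          (prodBernoulli w).real (openConnIn ((W : Set (Fin n))ᶜ) a b) := by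
  intro n w W o a b
  by_cases hoW : o ∈ W
  · refine prodBernoulli_real_inter_of_determinedBy_disjoint w
      (F := Finset.univ.filter fun e : Sym2 (Fin n) => ∃ x ∈ W, x ∈ e)
      (F' := Finset.univ.filter fun e : Sym2 (Fin n) => ∀ x ∈ e, x ∉ W) ?_
      (goodPM_determinedBy_cluster_eq o W hoW) ?_
      (Set.toFinite _).measurableSet (Set.toFinite _).measurableSet
    · rw [Finset.disjoint_left]
      intro e he he'
      obtain ⟨x, hxW, hxe⟩ := (Finset.mem_filter.1 he).2
      exact (Finset.mem_filter.1 he').2 x hxe hxW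
    · have hK : ((W : Set (Fin n))ᶜ).sym2 ⊆
          (↑(Finset.univ.filter fun e : Sym2 (Fin n) => ∀ x ∈ e, x ∉ W) : Set (Sym2 (Fin n))) := by
        intro e he
        rw [Finset.coe_filter]
        exact ⟨Finset.mem_univ _, fun x hx => Set.mem_sym2_iff_subset.1 he hx⟩
      exact DCT16.determinedBy_openConnIn ((W : Set (Fin n))ᶜ) a b hK
  · have hempty : {ω : BondConfig (Fin n) | openCluster ω o = (W : Set (Fin n))} = ∅ := by
      ext ω
      simp only [Set.mem_setOf_eq, Set.mem_empty_iff_false, iff_false]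
      intro h
      have ho : o ∈ openCluster ω o := SimpleGraph.Reachable.refl o
      rw [h] at ho
      exact hoW (Finset.mem_coe.1 ho)
    rw [hempty, Set.empty_inter, measureReal_empty, zero_mul]

end Summit.CriticalPhenomena.PercolationContinuityZ3.Theorems
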